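import Summits.AnomalousDissipation.AnomalousDissipation.Theorems.SolenoidalFractalHomogenisationLagrangianStepSidebandLadderInvariant
import Summits.AnomalousDissipation.AnomalousDissipation.Theorems.SolenoidalFractalHomogenisationLagrangianStepSidebandMask
import Summits.AnomalousDissipation.AnomalousDissipation.Theorems.SolenoidalFractalHomogenisationLagrangianStepSidebandAdjacentDecay
import Mathlib.MeasureTheory.Integral.IntervalIntegral.FundThmCalculus
import HarnessLib

/-!
# K1L_D `stub_D1_V0thg` (stmt-AnomalousDissipation-27980), R3′ lane, R3′-2 engine brick: THE CRUSHED PERIODIC RESPONSE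
# (the periodic sideband response of a source slot is small after the first HOPPING slot, from an abstract ladder-crush hypothesis)

Helper file of route `SolenoidalFractalHomogenisation` (`--supports stmt-AnomalousDissipation-27980 --as helper`; one-generation hand
`leafhand-ad-solenoidalfractalh-1` g1, road E-c).  The R3′ plan memo (`Cruxes/LagrangianRenormalisationStepDesign/Lines/onelevel-vtheta-R3-plan.md` §2, §5
R3′-2) bounds every CRUSHED slot pair of the tail `psiStar − excQS − pairQS` by inserting the enhanced-dissipation («crush») factor of the FIRST hopping
intermediate slot `i` after the source slot `j'` (now in the tree on single ladders: `Sideband.ladder_crush_slot_nu_exists`, `ladder_crush_quasistatic_nu`).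
The periodic response `N̄ = responseExt W₁ 𝔸 γ₁ R j'` is ONE trajectory whose state at the start `s` of slot `i` is NOT supported on a ladder (it carries the
memory of all earlier periods), so the single-ladder crush lemma does not apply to it verbatim.  This file supplies the missing FIXED-POINT ARGUMENT, for an
arbitrary word and purely from masks (no evolution operator, no existence theory):
* §1 `maskL_hopL_comm_of_closed`, `maskL_gen_comm_of_closed` — a coordinate mask onto ANY set closed under `± mᵢ` commutes with the generator while only
  slot `i` is active (generalises `maskL_hopL_comm_ladder`); `maskL_add_maskL_compl`;
* §2 **`hasDerivAt_responseExt_apply`** — the periodic extension `t ↦ N̄ t v` is differentiable at EVERY time (two-sided; so far the tree had the right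
  derivative `hasDerivWithinAt_responseExt` only): FTC on the continuous right derivative + `constant_of_has_deriv_right_zero`;
* §3 `hasDerivAt_maskL_responseExt_of_slot` — while the source of `j'` is off and only slot `i` is active, every closed mask of the response is a solution
  `u′ = gen(t) u` (the shape consumed by `norm_le_of_hasDerivAt_gen`, `mem_ladderSub_of_flow`, `ladder_crush_*`); `maskL_responseExt_mem_ladderSub`;
* §4 **`norm_responseExt_le_of_ladderCrush`** — THE CRUSHED PERIODIC RESPONSE.  Data: source window starting at `a`, a window `[s, e] ⊆ [a, a + P]` on which
  only slot `i` is active and the source of `j'` is off (off on all of `[s, a + P]`), the complement of `T = {m_{j'}, −m_{j'}}` CLOSED under the links active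
  on `[a, s)` (all those slots are STATIC for `± m_{j'}`), and an abstract crush hypothesis `‖u e‖² ≤ κ‖u s‖²` for solutions on `[s, e]` starting in the ladder
  subspaces of `± m_{j'} + ℤmᵢ`.  Conclusion: `‖N̄ e v‖ ≤ 2√κ·‖N̄ s v‖ + e^{−r(P−(e−s))}·‖N̄ e v‖`, `r = min(γ₁, 4π²lo')` — the two ladder parts are crushed,
  the rest of the state at `s` is the old memory `maskL Tᶜ (N̄ s v)` which contracted along `[a, s)` from `N̄ a v = N̄ (a+P) v`, itself the contraction of
  `N̄ e v` along `[e, a + P]`; and the solved form `norm_responseExt_le_of_ladderCrush'`.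
What is NOT here: the instantiation for the cubature word (`W₁ = (cubatureWord.stretch MB).stretch (1/ν)`, `κ = K·ν` from `ladder_crush_quasistatic_nu`,
the static-slot census `SidebandPathCensus`) = `D1TailCrushBound`.  No definitions, no sorry.  NOT a proof of `stub_D1_V0thg`, of K1L_D or of AD; rung
F-D1.A0 infrastructure.
-/

set_option linter.dupNamespace false -- single-conjunct summit: `Summit.AnomalousDissipation.AnomalousDissipation.…` is the mandated namespace

noncomputable section

namespace Summit.AnomalousDissipation.AnomalousDissipation.Theorems.SolenoidalFractalHomogenisation.LagrangianStep.Sideband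

open Set Complex MeasureTheory
open scoped InnerProductSpace
open Literature.Analysis Literature.Analysis.FunctionSpaces Literature.Analysis.FunctionSpaces.Torus
open Literature.Analysis.FluidPDE Literature.Analysis.FluidPDE.Torus Literature.Analysis.FluidPDE.LatticeShear
open Summit.AnomalousDissipation.AnomalousDissipation.Theorems.SolenoidalFractalHomogenisation.LagrangianStep.CellChain (linkCoeff)
open Summit.AnomalousDissipation.AnomalousDissipation.Theorems.SolenoidalFractalHomogenisation.PermissibleCarrier (period_pos)

variable {k₀ : ℕ}

/-! ## §1 Masks onto sets closed under `± mᵢ` commute with the slot's generator -/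

/-- **A mask onto a set closed under `± mᵢ` commutes with the slot's link operator** (`(hopLᵢ y)_z` only reads the fibres `z ∓ mᵢ`).
[cite: MeshalkinSinai1961, pp. 1700–1705] -/
theorem maskL_hopL_comm_of_closed (W₁ : LatticeWord k₀) (R : ℕ) (i : Fin k₀) {L : Set (Fin 3 → ℤ)}
    (hL : ∀ z, z + (W₁.phase i).m ∈ L ↔ z ∈ L) (y : Space R) :
    maskL R L (hopL W₁ R i y) = hopL W₁ R i (maskL R L y) := by
  have hsub : ∀ z, z - (W₁.phase i).m ∈ L ↔ z ∈ L := fun z => by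
    rw [← hL (z - (W₁.phase i).m), sub_add_cancel]
  apply PiLp.ext
  intro z
  rw [maskL_apply, hopL_apply, hopL_apply, linkBlock_apply, linkBlock_apply]
  by_cases hz : (z : Fin 3 → ℤ) ∈ L
  · rw [if_pos hz, coordL_maskL_of_mem ((hsub _).2 hz), coordL_maskL_of_mem ((hL _).2 hz)]
  · rw [if_neg hz, coordL_maskL_of_not_mem (fun h => hz ((hsub _).1 h)),
      coordL_maskL_of_not_mem (fun h => hz ((hL _).1 h)), map_zero, map_zero, smul_zero, smul_zero, add_zero, map_zero,
      smul_zero]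

/-- **A mask onto a set closed under `± mᵢ` commutes with the generator while only slot `i` is active** (`gen t = envᵢ(t)•hopLᵢ − dampL`).
[cite: MajdaKramer1999, §2.2.1.3 (cell problem (49))] -/
theorem maskL_gen_comm_of_closed (W₁ : LatticeWord k₀) (𝔸 : Torus.Visc4 (Fin 3)) (γ₁ : ℝ) (R : ℕ) (i : Fin k₀) {L : Set (Fin 3 → ℤ)}
    (hL : ∀ z, z + (W₁.phase i).m ∈ L ↔ z ∈ L) {t : ℝ} (hoff : ∀ j, j ≠ i → slotEnvelope W₁ j t = 0) (y : Space R) :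
    maskL R L (gen W₁ 𝔸 γ₁ R t y) = gen W₁ 𝔸 γ₁ R t (maskL R L y) := by
  rw [gen_eq_of_slot W₁ 𝔸 γ₁ R i hoff, sub_apply, sub_apply, smul_apply, smul_apply, map_sub, map_smul, maskL_hopL_comm_of_closed W₁ R i hL,
    maskL_dampL_comm]

/-- The complement of a set closed under `± mᵢ` is closed under `± mᵢ`. [folklore] -/
theorem compl_closed_of_closed {m : Fin 3 → ℤ} {L : Set (Fin 3 → ℤ)} (hL : ∀ z, z + m ∈ L ↔ z ∈ L) (z : Fin 3 → ℤ) : z + m ∈ Lᶜ ↔ z ∈ Lᶜ := by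
  rw [mem_compl_iff, mem_compl_iff, hL]

/-- A ladder `z₀ + ℤm` is closed under `± m`. [cite: MeshalkinSinai1961, pp. 1700–1705] -/
theorem ladder_closed (z₀ m z : Fin 3 → ℤ) : z + m ∈ ladder z₀ m ↔ z ∈ ladder z₀ m := add_mem_ladder_iff

/-- The union of two ladders of the same step is closed under `± m`. [cite: MeshalkinSinai1961, pp. 1700–1705] -/
theorem union_ladder_closed (z₁ z₂ m z : Fin 3 → ℤ) : z + m ∈ ladder z₁ m ∪ ladder z₂ m ↔ z ∈ ladder z₁ m ∪ ladder z₂ m := by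
  rw [mem_union, mem_union, add_mem_ladder_iff, add_mem_ladder_iff]

/-- `maskL A y + maskL Aᶜ y = y`. [folklore] -/
theorem maskL_add_maskL_compl {R : ℕ} (A : Set (Fin 3 → ℤ)) (y : Space R) : maskL R A y + maskL R Aᶜ y = y := by
  apply PiLp.ext
  intro z
  rw [PiLp.add_apply, maskL_apply, maskL_apply]
  by_cases hz : (z : Fin 3 → ℤ) ∈ A
  · rw [if_pos hz, if_neg (fun h : (z : Fin 3 → ℤ) ∈ Aᶜ => h hz), add_zero]
  · rw [if_neg hz, if_pos (mem_compl hz), zero_add]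

/-- For DISJOINT sets, `maskL A y + maskL B y = maskL (A ∪ B) y`. [folklore] -/
theorem maskL_add_maskL_of_disjoint {R : ℕ} {A B : Set (Fin 3 → ℤ)} (hAB : Disjoint A B) (y : Space R) :
    maskL R A y + maskL R B y = maskL R (A ∪ B) y := by
  apply PiLp.ext
  intro z
  rw [PiLp.add_apply, maskL_apply, maskL_apply, maskL_apply]
  by_cases hA : (z : Fin 3 → ℤ) ∈ A
  · rw [if_pos hA, if_neg (Set.disjoint_left.1 hAB hA), if_pos (mem_union_left B hA), add_zero]
  · by_cases hB : (z : Fin 3 → ℤ) ∈ B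
    · rw [if_neg hA, if_pos hB, if_pos (mem_union_right A hB), zero_add]
    · rw [if_neg hA, if_neg hB, if_neg (by rintro (h | h) <;> contradiction), add_zero]

/-- The norm of a mask onto a subset is at most the norm of the mask onto the superset. [folklore] -/
theorem norm_maskL_le_of_subset {R : ℕ} {A B : Set (Fin 3 → ℤ)} (hAB : A ⊆ B) (y : Space R) : ‖maskL R A y‖ ≤ ‖maskL R B y‖ := by
  rw [← maskL_maskL_of_subset hAB y]
  exact norm_maskL_le A _


/-! ## §2 The periodic extension of the response is differentiable at every time -/

/-- **`t ↦ N̄ t v` is differentiable EVERYWHERE (two-sided)**, with derivative `Sⱼ(t) v + G(t) (N̄ t v)`: the right derivative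
(`hasDerivWithinAt_responseExt`) is continuous in `t`, so `N̄ · v` is its primitive (`constant_of_has_deriv_right_zero`) and the fundamental theorem of
calculus gives the two-sided derivative. [cite: SandersVerhulstMurdock2007, Lemma 5.2.7 (linear case)] -/
theorem hasDerivAt_responseExt_apply (W₁ : LatticeWord k₀) (𝔸 : Torus.Visc4 (Fin 3)) (γ₁ : ℝ) (R : ℕ) (j : Fin k₀)
    (hN : IsPeriodicResponse W₁ 𝔸 γ₁ R j (response W₁ 𝔸 γ₁ R j)) (v : EuclideanSpace ℂ (Fin 3)) (t : ℝ) :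
    HasDerivAt (fun s => responseExt W₁ 𝔸 γ₁ R j s v)
      (source W₁ R j t v + gen W₁ 𝔸 γ₁ R t (responseExt W₁ 𝔸 γ₁ R j t v)) t := by
  set N := responseExt W₁ 𝔸 γ₁ R j with hNdef
  set g : ℝ → Space R := fun s => source W₁ R j s v + gen W₁ 𝔸 γ₁ R s (N s v) with hg
  have hNc : Continuous fun s => N s v := (continuous_responseExt W₁ 𝔸 γ₁ R j hN).clm_apply continuous_const
  have hgc : Continuous g :=
    ((continuous_source W₁ R j).clm_apply continuous_const).add ((continuous_gen W₁ 𝔸 γ₁ R).clm_apply hNc)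
  -- the primitive of the right derivative
  set G : ℝ → Space R := fun s => N 0 v + ∫ x in (0:ℝ)..s, g x with hG
  have hGd : ∀ s, HasDerivAt G (g s) s := fun s => by
    have h := (hgc.integral_hasStrictDerivAt 0 s).hasDerivAt
    exact h.const_add (N 0 v)
  -- right derivative of `N · v`
  have hNd : ∀ s, HasDerivWithinAt (fun σ => N σ v) (g s) (Ici s) s := fun s => by
    have h1 := (hasDerivWithinAt_responseExt W₁ 𝔸 γ₁ R j hN s).clm_apply (hasDerivWithinAt_const s (Ici s) v)
    refine h1.congr_deriv ?_
    simp only [hg, hNdef, ContinuousLinearMap.coe_restrictScalars', add_apply, ContinuousLinearMap.comp_apply, map_zero,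
      add_zero]
  -- the difference has zero right derivative everywhere, hence is constant (= 0 at `0`)
  set h : ℝ → Space R := fun s => N s v - G s with hh
  have hhc : Continuous h := hNc.sub (continuous_iff_continuousAt.2 fun s => (hGd s).continuousAt)
  have hhd : ∀ s, HasDerivWithinAt h 0 (Ici s) s := fun s => by
    have := (hNd s).sub (hGd s).hasDerivWithinAt
    rwa [sub_self] at this
  have hh0 : h 0 = 0 := by
    simp only [hh, hG, intervalIntegral.integral_same, add_zero, sub_self]
  have hzero : ∀ s, h s = 0 := by
    intro s
    rcases le_or_gt 0 s with hs | hs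
    · rw [constant_of_has_deriv_right_zero hhc.continuousOn (fun x _ => hhd x) s ⟨hs, le_rfl⟩, hh0]
    · have := constant_of_has_deriv_right_zero (a := s) (b := 0) hhc.continuousOn (fun x _ => hhd x) 0 ⟨hs.le, le_rfl⟩
      rw [hh0] at this
      exact this.symm
  have hNG : (fun s => N s v) = G := funext fun s => sub_eq_zero.1 (hzero s)
  rw [hNG]
  exact hGd t

/-- The same statement in the `restrictScalars` shape of the tree's ODE hypotheses, on a window where the source of slot `j` is OFF:
`u′ = gen(t) u` for `u t = N̄ t v`. [cite: SandersVerhulstMurdock2007, Lemma 5.2.7 (linear case)] -/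
theorem hasDerivAt_responseExt_apply_of_envelope_zero (W₁ : LatticeWord k₀) (𝔸 : Torus.Visc4 (Fin 3)) (γ₁ : ℝ) (R : ℕ) (j : Fin k₀)
    (hN : IsPeriodicResponse W₁ 𝔸 γ₁ R j (response W₁ 𝔸 γ₁ R j)) (v : EuclideanSpace ℂ (Fin 3)) {t : ℝ} (ht : slotEnvelope W₁ j t = 0) :
    HasDerivAt (fun s => responseExt W₁ 𝔸 γ₁ R j s v)
      (((gen W₁ 𝔸 γ₁ R t).restrictScalars ℝ) (responseExt W₁ 𝔸 γ₁ R j t v)) t := by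
  have h := hasDerivAt_responseExt_apply W₁ 𝔸 γ₁ R j hN v t
  rwa [source_eq_zero_of_slotEnvelope W₁ R j ht, zero_apply, zero_add, ← ContinuousLinearMap.coe_restrictScalars' (R := ℝ)] at h

/-! ## §3 Closed masks of the response are solutions while the source is off and one slot is active -/

/-- **A CLOSED MASK OF THE RESPONSE IS A SOLUTION ON A ONE-SLOT WINDOW.**  If on `[s, e]` the envelope of the source slot `j` vanishes and all slots
other than `i` are off, then for every set `L` closed under `± mᵢ` the masked response `u t = maskL L (N̄ t v)` satisfies `u′ = gen(t) u` on `[s, e]`.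
[cite: MajdaKramer1999, §2.2.1.3 (cell problem (49))] -/
theorem hasDerivAt_maskL_responseExt_of_slot (W₁ : LatticeWord k₀) (𝔸 : Torus.Visc4 (Fin 3)) (γ₁ : ℝ) (R : ℕ) (j i : Fin k₀)
    (hN : IsPeriodicResponse W₁ 𝔸 γ₁ R j (response W₁ 𝔸 γ₁ R j)) (v : EuclideanSpace ℂ (Fin 3)) {L : Set (Fin 3 → ℤ)}
    (hL : ∀ z, z + (W₁.phase i).m ∈ L ↔ z ∈ L) {s e : ℝ} (hsrc : ∀ t ∈ Icc s e, slotEnvelope W₁ j t = 0)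
    (hoff : ∀ t ∈ Icc s e, ∀ l, l ≠ i → slotEnvelope W₁ l t = 0) :
    ∀ t ∈ Icc s e, HasDerivAt (fun σ => maskL R L (responseExt W₁ 𝔸 γ₁ R j σ v))
      (((gen W₁ 𝔸 γ₁ R t).restrictScalars ℝ) (maskL R L (responseExt W₁ 𝔸 γ₁ R j t v))) t := by
  intro t ht
  have h1 := hasDerivAt_responseExt_apply_of_envelope_zero W₁ 𝔸 γ₁ R j hN v (hsrc t ht)
  have h2 := ((maskL R L).restrictScalars ℝ).hasFDerivAt.comp_hasDerivAt t h1
  refine h2.congr_deriv ?_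
  simp only [ContinuousLinearMap.coe_restrictScalars']
  exact maskL_gen_comm_of_closed W₁ 𝔸 γ₁ R i hL (hoff t ht) _

/-- The unmasked response is a solution on such a window. [cite: MajdaKramer1999, §2.2.1.3 (cell problem (49))] -/
theorem hasDerivAt_responseExt_of_slot (W₁ : LatticeWord k₀) (𝔸 : Torus.Visc4 (Fin 3)) (γ₁ : ℝ) (R : ℕ) (j : Fin k₀)
    (hN : IsPeriodicResponse W₁ 𝔸 γ₁ R j (response W₁ 𝔸 γ₁ R j)) (v : EuclideanSpace ℂ (Fin 3)) {s e : ℝ}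
    (hsrc : ∀ t ∈ Icc s e, slotEnvelope W₁ j t = 0) :
    ∀ t ∈ Icc s e, HasDerivAt (fun σ => responseExt W₁ 𝔸 γ₁ R j σ v)
      (((gen W₁ 𝔸 γ₁ R t).restrictScalars ℝ) (responseExt W₁ 𝔸 γ₁ R j t v)) t :=
  fun t ht => hasDerivAt_responseExt_apply_of_envelope_zero W₁ 𝔸 γ₁ R j hN v (hsrc t ht)

/-- **A masked response from the ladder subspace**: for a TRANSVERSAL-producing datum (`lo' > 0`, `γ₁ > 0`: the response is transversal,
`transversalProj_responseExt_apply`), `maskL L (N̄ t v) ∈ ladderSub R L` for every set `L`. [cite: Temam1984, Ch. III §1.1] -/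
theorem maskL_responseExt_mem_ladderSub (W₁ : LatticeWord k₀) {𝔸 : Torus.Visc4 (Fin 3)} {lo' hi' : ℝ} (h𝔸 : Torus.NearIso 𝔸 lo' hi')
    (hlo' : 0 < lo') {γ₁ : ℝ} (hγ₁ : 0 < γ₁) (R : ℕ) (j : Fin k₀) (L : Set (Fin 3 → ℤ)) (t : ℝ) (v : EuclideanSpace ℂ (Fin 3)) :
    maskL R L (responseExt W₁ 𝔸 γ₁ R j t v) ∈ ladderSub R L := by
  refine mem_ladderSub.2 fun z => ⟨fun hz => maskL_apply_of_not_mem hz _, ?_⟩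
  by_cases hz : (z : Fin 3 → ℤ) ∈ L
  · rw [maskL_apply_of_mem hz, ← transversalProj_responseExt_apply W₁ h𝔸 hlo' hγ₁ j t v z]
    exact CellChain.kdot_transversalProj' _ _
  · rw [maskL_apply_of_not_mem hz, map_zero]


/-- The difference of two sets closed under `± m` is closed under `± m`. [folklore] -/
theorem diff_closed_of_closed {m : Fin 3 → ℤ} {A B : Set (Fin 3 → ℤ)} (hA : ∀ z, z + m ∈ A ↔ z ∈ A) (hB : ∀ z, z + m ∈ B ↔ z ∈ B)
    (z : Fin 3 → ℤ) : z + m ∈ A \ B ↔ z ∈ A \ B := by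
  rw [Set.mem_sdiff, Set.mem_sdiff, hA, hB]

/-- The ladder subspace is monotone in the support set. [cite: MajdaKramer1999, §2.2.1.3] -/
theorem ladderSub_mono {R : ℕ} {A B : Set (Fin 3 → ℤ)} (hAB : A ⊆ B) : ladderSub R A ≤ ladderSub R B :=
  fun _ hy => mem_ladderSub.2 fun z => ⟨fun hz => ((mem_ladderSub.1 hy) z).1 fun h => hz (hAB h), ((mem_ladderSub.1 hy) z).2⟩

/-! ## §4 The crushed periodic response -/

/-- **THE CRUSHED PERIODIC RESPONSE (raw fixed-point form).**  Word `W₁`, `NearIso 𝔸 lo' hi'` (`lo' > 0`), `γ₁ > 0`, truncation `R`, source slot `j`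
with fibres `± m_j`, hopping slot `i`, `N̄ = responseExt W₁ 𝔸 γ₁ R j`, `r = min(γ₁, 4π²lo')`.  Times `a ≤ s ≤ e ≤ a + P`: on `[a, s)` no ACTIVE link joins a
fibre of `T = {m_j, −m_j}` to a retained fibre outside `T` (`hstatic`: the source slot and the intermediate slots are static for `± m_j`); on `[s, a + P]`
the envelope of `j` vanishes (`hsrc`); on `[s, e]` only slot `i` is active (`hoff`); and every solution `u′ = gen(t) u` on `[s, e]` starting in the ladder
subspace of `± m_j + ℤmᵢ` obeys `‖u e‖² ≤ κ‖u s‖²` (`hcrush`, e.g. `ladder_crush_quasistatic_nu`).  THEN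
`‖N̄ e v‖ ≤ 2√κ·‖N̄ s v‖ + e^{−r(P − (e − s))}·‖N̄ e v‖`.
Proof: `N̄ e v = maskL L₁ + maskL (L₂∖L₁) + maskL (L₁∪L₂)ᶜ` of itself (`Lₖ` the two ladders); each masked response is a solution on `[s,e]` (§3); the two
ladder parts are crushed; the third contracts to `‖maskL (L₁∪L₂)ᶜ (N̄ s v)‖ ≤ ‖maskL Tᶜ (N̄ s v)‖ ≤ e^{−r(s−a)}‖N̄ a v‖` (masked decay, `Tᶜ` closed on
`[a,s)`, the mask kills the source) and `N̄ a v = N̄ (a+P) v`, `‖N̄ (a+P) v‖ ≤ e^{−r(a+P−e)}‖N̄ e v‖` (plain decay, source off).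
[cite: BedrossianCotiZelati2017, §2 (hypocoercivity, enhanced dissipation)] [cite: SandersVerhulstMurdock2007, Lemma 5.2.7 (linear case)]
[cite: MajdaKramer1999, §2.2.1.3 (cell problem (49))] -/
theorem norm_responseExt_le_of_ladderCrush (W₁ : LatticeWord k₀) {𝔸 : Torus.Visc4 (Fin 3)} {lo' hi' : ℝ} (h𝔸 : Torus.NearIso 𝔸 lo' hi')
    (hlo' : 0 < lo') {γ₁ : ℝ} (hγ₁ : 0 < γ₁) (R : ℕ) (j i : Fin k₀) (v : EuclideanSpace ℂ (Fin 3))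
    {a s e : ℝ} (has : a ≤ s) (hse : s ≤ e) (heP : e ≤ a + W₁.period)
    (hstatic : ∀ t ∈ Ico a s, ∀ (l : Fin k₀) (z : box R), (z : Fin 3 → ℤ) ≠ (W₁.phase j).m → (z : Fin 3 → ℤ) ≠ -(W₁.phase j).m →
      ∀ w : Fin 3 → ℤ, (w = z.1 - (W₁.phase l).m ∨ w = z.1 + (W₁.phase l).m) → w ∈ box R →
      (w = (W₁.phase j).m ∨ w = -(W₁.phase j).m) → linkCoeff W₁ 1 z.1 l t = 0)
    (hsrc : ∀ t ∈ Icc s (a + W₁.period), slotEnvelope W₁ j t = 0)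
    (hoff : ∀ t ∈ Icc s e, ∀ l, l ≠ i → slotEnvelope W₁ l t = 0)
    {κ : ℝ} (hκ : 0 ≤ κ)
    (hcrush : ∀ z₀ : Fin 3 → ℤ, (z₀ = (W₁.phase j).m ∨ z₀ = -(W₁.phase j).m) → ∀ u : ℝ → Space R,
      (∀ t ∈ Icc s e, HasDerivAt u (((gen W₁ 𝔸 γ₁ R t).restrictScalars ℝ) (u t)) t) →
      u s ∈ ladderSub R (ladder z₀ (W₁.phase i).m) → ‖u e‖ ^ 2 ≤ κ * ‖u s‖ ^ 2) :
    ‖responseExt W₁ 𝔸 γ₁ R j e v‖ ≤ 2 * Real.sqrt κ * ‖responseExt W₁ 𝔸 γ₁ R j s v‖ +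
      Real.exp (-(min γ₁ (4 * Real.pi ^ 2 * lo') * (W₁.period - (e - s)))) * ‖responseExt W₁ 𝔸 γ₁ R j e v‖ := by
  have hN := isPeriodicResponse_response_of_nearIso W₁ h𝔸 hlo' hγ₁ R j
  -- the two ladders through `± m_j` and the source fibres
  have hTL : ({z | z = (W₁.phase j).m ∨ z = -(W₁.phase j).m} : Set (Fin 3 → ℤ)) ⊆
      ladder (W₁.phase j).m (W₁.phase i).m ∪ ladder (-(W₁.phase j).m) (W₁.phase i).m := by
    rintro z (hz | hz)
    · rw [mem_union]; left; rw [hz]; exact self_mem_ladder _ _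
    · rw [mem_union]; right; rw [hz]; exact self_mem_ladder _ _
  have hsrc' : ∀ t ∈ Icc s e, slotEnvelope W₁ j t = 0 := fun t ht => hsrc t ⟨ht.1, ht.2.trans heP⟩
  -- (1) the old memory at `s` is the contraction of the state at `a`
  have hold : ‖maskL R {z | z = (W₁.phase j).m ∨ z = -(W₁.phase j).m}ᶜ (responseExt W₁ 𝔸 γ₁ R j s v)‖ ≤
      Real.exp (-(min γ₁ (4 * Real.pi ^ 2 * lo') * (s - a))) * ‖responseExt W₁ 𝔸 γ₁ R j a v‖ := by
    have h := norm_maskL_responseExt_le_exp W₁ h𝔸 hlo'.le γ₁ R j hN {z | z = (W₁.phase j).m ∨ z = -(W₁.phase j).m}ᶜ v has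
      (fun t ht l z hz w hw hwb hwT =>
        hstatic t ht l z (fun h => hz (Or.inl h)) (fun h => hz (Or.inr h)) w hw hwb (not_not.1 hwT))
      (fun t _ => maskL_source_eq_zero W₁ R j t v (fun h => h (Or.inl rfl)) (fun h => h (Or.inr rfl)))
    exact h.trans (mul_le_mul_of_nonneg_left (norm_maskL_le _ _) (Real.exp_pos _).le)
  -- (2) periodicity and plain decay on `[e, a + P]`
  have hwrap : ‖responseExt W₁ 𝔸 γ₁ R j a v‖ ≤
      Real.exp (-(min γ₁ (4 * Real.pi ^ 2 * lo') * (a + W₁.period - e))) * ‖responseExt W₁ 𝔸 γ₁ R j e v‖ := by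
    have h := norm_responseExt_le_exp_of_envelope_zero W₁ h𝔸 hlo'.le γ₁ R j hN v heP
      (fun t ht => hsrc t ⟨hse.trans ht.1, ht.2.le⟩)
    rwa [responseExt_add_period] at h
  -- (3) a closed part inside one of the two ladders is crushed
  have hcr : ∀ (z₀ : Fin 3 → ℤ), (z₀ = (W₁.phase j).m ∨ z₀ = -(W₁.phase j).m) → ∀ A : Set (Fin 3 → ℤ),
      (∀ z, z + (W₁.phase i).m ∈ A ↔ z ∈ A) → A ⊆ ladder z₀ (W₁.phase i).m →
      ‖maskL R A (responseExt W₁ 𝔸 γ₁ R j e v)‖ ≤ Real.sqrt κ * ‖responseExt W₁ 𝔸 γ₁ R j s v‖ := by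
    intro z₀ hz₀ A hA hAL
    have hsol := hasDerivAt_maskL_responseExt_of_slot W₁ 𝔸 γ₁ R j i hN v hA hsrc' hoff
    have hmem : maskL R A (responseExt W₁ 𝔸 γ₁ R j s v) ∈ ladderSub R (ladder z₀ (W₁.phase i).m) :=
      ladderSub_mono hAL (maskL_responseExt_mem_ladderSub W₁ h𝔸 hlo' hγ₁ R j A s v)
    have h := hcrush z₀ hz₀ (fun t => maskL R A (responseExt W₁ 𝔸 γ₁ R j t v)) hsol hmem
    have hus : ‖maskL R A (responseExt W₁ 𝔸 γ₁ R j s v)‖ ≤ ‖responseExt W₁ 𝔸 γ₁ R j s v‖ := norm_maskL_le _ _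
    have h2 : ‖maskL R A (responseExt W₁ 𝔸 γ₁ R j e v)‖ ^ 2 ≤ (Real.sqrt κ * ‖responseExt W₁ 𝔸 γ₁ R j s v‖) ^ 2 := by
      rw [mul_pow, Real.sq_sqrt hκ]
      refine h.trans (mul_le_mul_of_nonneg_left ?_ hκ)
      exact pow_le_pow_left₀ (norm_nonneg _) hus 2
    exact (abs_le_of_sq_le_sq' h2 (by positivity)).2
  -- (4) the remainder contracts on `[s, e]` and sits inside the old memory at `s`
  have hrest : ‖maskL R (ladder (W₁.phase j).m (W₁.phase i).m ∪ ladder (-(W₁.phase j).m) (W₁.phase i).m)ᶜ (responseExt W₁ 𝔸 γ₁ R j e v)‖ ≤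
      ‖maskL R {z | z = (W₁.phase j).m ∨ z = -(W₁.phase j).m}ᶜ (responseExt W₁ 𝔸 γ₁ R j s v)‖ := by
    have hsol := hasDerivAt_maskL_responseExt_of_slot W₁ 𝔸 γ₁ R j i hN v
      (compl_closed_of_closed (union_ladder_closed (W₁.phase j).m (-(W₁.phase j).m) (W₁.phase i).m)) hsrc' hoff
    exact (norm_le_of_hasDerivAt_gen W₁ h𝔸 hlo'.le hγ₁.le R hse hsol).trans (norm_maskL_le_of_subset (compl_subset_compl.2 hTL) _)
  -- (5) assemble
  have hL₁ := ladder_closed (W₁.phase j).m (W₁.phase i).m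
  have hL₂ := ladder_closed (-(W₁.phase j).m) (W₁.phase i).m
  have hsplit : responseExt W₁ 𝔸 γ₁ R j e v =
      maskL R (ladder (W₁.phase j).m (W₁.phase i).m) (responseExt W₁ 𝔸 γ₁ R j e v) +
      maskL R (ladder (-(W₁.phase j).m) (W₁.phase i).m \ ladder (W₁.phase j).m (W₁.phase i).m) (responseExt W₁ 𝔸 γ₁ R j e v) +
      maskL R (ladder (W₁.phase j).m (W₁.phase i).m ∪ ladder (-(W₁.phase j).m) (W₁.phase i).m)ᶜ (responseExt W₁ 𝔸 γ₁ R j e v) := by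
    rw [maskL_add_maskL_of_disjoint Set.disjoint_sdiff_right, Set.union_sdiff_self, maskL_add_maskL_compl]
  have h1 := hcr (W₁.phase j).m (Or.inl rfl) _ hL₁ subset_rfl
  have h2 := hcr (-(W₁.phase j).m) (Or.inr rfl) _ (diff_closed_of_closed hL₂ hL₁) Set.sdiff_subset
  have hexp : Real.exp (-(min γ₁ (4 * Real.pi ^ 2 * lo') * (s - a))) * Real.exp (-(min γ₁ (4 * Real.pi ^ 2 * lo') * (a + W₁.period - e))) =
      Real.exp (-(min γ₁ (4 * Real.pi ^ 2 * lo') * (W₁.period - (e - s)))) := by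
    rw [← Real.exp_add]; congr 1; ring
  calc ‖responseExt W₁ 𝔸 γ₁ R j e v‖
      ≤ ‖maskL R (ladder (W₁.phase j).m (W₁.phase i).m) (responseExt W₁ 𝔸 γ₁ R j e v)‖ +
        ‖maskL R (ladder (-(W₁.phase j).m) (W₁.phase i).m \ ladder (W₁.phase j).m (W₁.phase i).m) (responseExt W₁ 𝔸 γ₁ R j e v)‖ +
        ‖maskL R (ladder (W₁.phase j).m (W₁.phase i).m ∪ ladder (-(W₁.phase j).m) (W₁.phase i).m)ᶜ (responseExt W₁ 𝔸 γ₁ R j e v)‖ := by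
          conv_lhs => rw [hsplit]
          exact (norm_add_le _ _).trans (add_le_add (norm_add_le _ _) le_rfl)
    _ ≤ Real.sqrt κ * ‖responseExt W₁ 𝔸 γ₁ R j s v‖ + Real.sqrt κ * ‖responseExt W₁ 𝔸 γ₁ R j s v‖ +
        Real.exp (-(min γ₁ (4 * Real.pi ^ 2 * lo') * (s - a))) *
          (Real.exp (-(min γ₁ (4 * Real.pi ^ 2 * lo') * (a + W₁.period - e))) * ‖responseExt W₁ 𝔸 γ₁ R j e v‖) := by
          refine add_le_add (add_le_add h1 h2) (hrest.trans (hold.trans ?_))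
          exact mul_le_mul_of_nonneg_left hwrap (Real.exp_pos _).le
    _ = 2 * Real.sqrt κ * ‖responseExt W₁ 𝔸 γ₁ R j s v‖ +
        Real.exp (-(min γ₁ (4 * Real.pi ^ 2 * lo') * (W₁.period - (e - s)))) * ‖responseExt W₁ 𝔸 γ₁ R j e v‖ := by
          rw [← hexp]; ring

/-- **THE CRUSHED PERIODIC RESPONSE (solved form).**  Under the hypotheses of `norm_responseExt_le_of_ladderCrush`, with `θ := e^{−r(P − (e − s))} < 1`:
`‖N̄ e v‖ ≤ 2√κ/(1 − θ) · ‖N̄ s v‖` — and `‖N̄ s v‖ ≤ (8π‖αⱼ‖/r)·‖P_{mⱼ} v‖` (`norm_responseExt_apply_le`), so the response of slot `j` is crushed by `√κ`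
from the end of its first hopping slot until its source switches on again (plain contraction afterwards, `norm_responseExt_le_exp_of_envelope_zero`).
[cite: BedrossianCotiZelati2017, §2 (hypocoercivity, enhanced dissipation)] [cite: SandersVerhulstMurdock2007, Lemma 5.2.7 (linear case)] -/
theorem norm_responseExt_le_of_ladderCrush' (W₁ : LatticeWord k₀) {𝔸 : Torus.Visc4 (Fin 3)} {lo' hi' : ℝ} (h𝔸 : Torus.NearIso 𝔸 lo' hi')
    (hlo' : 0 < lo') {γ₁ : ℝ} (hγ₁ : 0 < γ₁) (R : ℕ) (j i : Fin k₀) (v : EuclideanSpace ℂ (Fin 3))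
    {a s e : ℝ} (has : a ≤ s) (hse : s ≤ e) (heP : e ≤ a + W₁.period)
    (hstatic : ∀ t ∈ Ico a s, ∀ (l : Fin k₀) (z : box R), (z : Fin 3 → ℤ) ≠ (W₁.phase j).m → (z : Fin 3 → ℤ) ≠ -(W₁.phase j).m →
      ∀ w : Fin 3 → ℤ, (w = z.1 - (W₁.phase l).m ∨ w = z.1 + (W₁.phase l).m) → w ∈ box R →
      (w = (W₁.phase j).m ∨ w = -(W₁.phase j).m) → linkCoeff W₁ 1 z.1 l t = 0)
    (hsrc : ∀ t ∈ Icc s (a + W₁.period), slotEnvelope W₁ j t = 0)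
    (hoff : ∀ t ∈ Icc s e, ∀ l, l ≠ i → slotEnvelope W₁ l t = 0)
    {κ : ℝ} (hκ : 0 ≤ κ)
    (hcrush : ∀ z₀ : Fin 3 → ℤ, (z₀ = (W₁.phase j).m ∨ z₀ = -(W₁.phase j).m) → ∀ u : ℝ → Space R,
      (∀ t ∈ Icc s e, HasDerivAt u (((gen W₁ 𝔸 γ₁ R t).restrictScalars ℝ) (u t)) t) →
      u s ∈ ladderSub R (ladder z₀ (W₁.phase i).m) → ‖u e‖ ^ 2 ≤ κ * ‖u s‖ ^ 2)
    {θ : ℝ} (hθ : Real.exp (-(min γ₁ (4 * Real.pi ^ 2 * lo') * (W₁.period - (e - s)))) ≤ θ) (hθ1 : θ < 1) :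
    ‖responseExt W₁ 𝔸 γ₁ R j e v‖ ≤ 2 * Real.sqrt κ / (1 - θ) * ‖responseExt W₁ 𝔸 γ₁ R j s v‖ := by
  have h := norm_responseExt_le_of_ladderCrush W₁ h𝔸 hlo' hγ₁ R j i v has hse heP hstatic hsrc hoff hκ hcrush
  have hX := norm_nonneg (responseExt W₁ 𝔸 γ₁ R j e v)
  have h' : ‖responseExt W₁ 𝔸 γ₁ R j e v‖ ≤ 2 * Real.sqrt κ * ‖responseExt W₁ 𝔸 γ₁ R j s v‖ + θ * ‖responseExt W₁ 𝔸 γ₁ R j e v‖ :=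
    h.trans (add_le_add le_rfl (mul_le_mul_of_nonneg_right hθ hX))
  rw [div_mul_eq_mul_div, le_div_iff₀ (by linarith)]
  nlinarith

end Summit.AnomalousDissipation.AnomalousDissipation.Theorems.SolenoidalFractalHomogenisation.LagrangianStep.Sideband

end
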